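import Literature.Barriers.CriticalPhenomena.LaceExpansionIsingDeconvolutionThm22Cube
import Literature.Barriers.CriticalPhenomena.LaceExpansionIsingGreenComparisonSymbols
import HarnessLib

/-!
# Liu–Slade 2026, Proposition 3.2 (towards `LiuSlade2026_thm22_holds`), I: the symbols
# `Σ_x P(x) x_l^m cos(k·x + mπ/2)` on the cube, their slice derivatives, and the truncation of `Π`

Barrier catalogue `Literature/Barriers/CriticalPhenomena/` (D-0021), proofs companion of the
named fact `LiuSlade2026_thm22` (Liu–Slade 2026, Theorem 2.2), continuing the reductions
`LiuSlade2026_thm22_of_prop32` / `LiuSlade2026_thm22_of_prop32_cube`, which leave Proposition 3.2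
(the `L¹` bounds (3.8)–(3.9) on `f̂_z = 1/F̂_z - λ_z/Â_{μ_z}` and its `n_d`-th derivatives) as
the obligation. The printed proof (§3.1–3.2) differentiates `f̂ = Ê/(ÂF̂)` by the product and
quotient rules and bounds the resulting products of `Â_δ/Â`, `Ê_{α}/(ÂF̂)`, `F̂_γ/F̂` in `L^q`
by Hölder's inequality (Lemma 3.3), the derivatives being WEAK ones (Liu–Slade 2024, App. A). In
Lean the derivatives are taken CLASSICALLY on smooth approximants — `Π_z` truncated to finite
support (so that every symbol is a trigonometric polynomial) and the denominators shifted by a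
mass — followed by a weak limit; the character-tested identity asked for by the cube reduction is
exactly what survives that limit. This file supplies the OBJECTS of that argument (definitions with
their elementary API; no named facts):

* `symbD P l m k = Σ_x P(x) x_l^m cos(k·x + mπ/2)` — the `m`-th derivative in the direction `e_l`
  of the (real) transform `Σ_x P(x)cos(k·x)` of a `ℤ^d`-symmetric `P` (a `tsum`; for finitely
  supported `P` a finite sum, `symbD_eq_sum`); `symbD_soStep : symbD D = soSymbolD` (the tree's
  slice derivatives of `D̂`), `symbD_delta0`, linearity, `latticeFT_eq_symbD_zero`;
* for finitely supported `P`: `hasDerivAt_symbD_slice` (`(d/ds) symbD P l m (k[l↦s]) = symbD P l (m+1)`),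
  `continuous_symbD`, `2π`-periodicity in `k_l` (`symbD_update_add_two_pi`), and the bound
  `|symbD P l m k| ≤ Σ_x |P(x)||x_l|^m`;
* `piTrunc P R` — the truncation of `Π` to `|x| ≤ R` with the tail mass put back at the origin
  (`Σ_x piTrunc P R x = Σ_x P x`, so that `F̂_z(0) ≥ 0` of Assumption 2.1 is preserved), its
  finite support, its `ℤ^d`-symmetry and its decay bound
  `|piTrunc P R x| ≤ (β₀ + t_R)δ_{0,x} + β₁/⟦x⟧^{d+2+ρ}` with the tail `t_R = |Σ_{|y|>R} P(y)|`.

## References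

* Y. Liu, G. Slade, *Gaussian deconvolution and the lace expansion for spread-out models*,
  Ann. Inst. H. Poincaré Probab. Statist. 62 (2026), arXiv:2310.07640: §3.1 ((3.5), Prop. 3.2,
  (3.10)), §3.2 (Lemma 3.3), Assumption 2.1 with (2.2) [LiuSlade2026].
* Y. Liu, G. Slade, *Gaussian deconvolution and the lace expansion*, Probab. Theory Related
  Fields 195 (2024), arXiv:2310.07635: Appendix A, Lemma A.4 (derivatives of the transform of a
  lattice function: `∇^α f̂ = 𝓕[(ix)^α f]`) [LiuSlade2024].
-/

noncomputable section

namespace Literature.Barriers.CriticalPhenomena.SpreadOutIsing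

open _root_.MeasureTheory Filter _root_.Topology Finset Literature.Probability.LatticeModels
open scoped BigOperators Real

variable {d L : ℕ}

/-! ## Part 1. The slice-derivative symbols `Σ_x P(x) x_l^m cos(k·x + mπ/2)` -/

/-- The `m`-th derivative in the coordinate direction `e_l` of the transform `Σ_x P(x)cos(k·x)` of a
lattice function `P`, as the series `Σ_x P(x) x_l^m cos(k·x + mπ/2)` (from
`(d/dt)^m cos(at + b) = a^m cos(at + b + mπ/2)`; for a `ℤ^d`-symmetric summable `P`,
`Σ_x P(x)cos(k·x) = P̂(k)`, and for `|α| = m` derivatives Liu–Slade write `P̂_α = 𝓕[(ix)^α P]`).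
A real `tsum` (junk value `0` where the series diverges; below `P` is finitely supported or has the
required moments). [cite: LiuSlade2024, Appendix A, Lemma A.4] [cite: LiuSlade2026, §3.1 (Ê_α = ∇^α Ê, F̂_γ, Â_δ)] -/
def symbD (P : Site d → ℝ) (l : Fin d) (m : ℕ) (k : Fin d → ℝ) : ℝ :=
  ∑' x, P x * (((x l : ℤ) : ℝ) ^ m * Real.cos (kdot k x + m * (π / 2)))

/-- Order zero: `symbD P l 0 k = Σ_x P(x)cos(k·x)`. [folklore] -/
theorem symbD_zero (P : Site d → ℝ) (l : Fin d) (k : Fin d → ℝ) :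
    symbD P l 0 k = ∑' x, P x * Real.cos (kdot k x) := by
  unfold symbD
  exact tsum_congr fun x => by simp

/-- For a finitely supported `P` the series is a finite sum. [folklore] -/
theorem symbD_eq_sum {P : Site d → ℝ} {S : Finset (Site d)} (hS : ∀ x ∉ S, P x = 0) (l : Fin d) (m : ℕ)
    (k : Fin d → ℝ) :
    symbD P l m k = ∑ x ∈ S, P x * (((x l : ℤ) : ℝ) ^ m * Real.cos (kdot k x + m * (π / 2))) :=
  tsum_eq_sum fun x hx => by rw [hS x hx, zero_mul]

/-- **`symbD D = soSymbolD`**: for the spread-out step distribution the symbols are the tree's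
slice derivatives of `D̂`. [cite: LiuSlade2026, App. B (D̂_α)] -/
theorem symbD_soStep (l : Fin d) (m : ℕ) (k : Fin d → ℝ) :
    symbD (soStep d L) l m k = soSymbolD d L l m k := by
  rw [symbD_eq_sum (S := (spreadOutGraph d L).neighborFinset 0)
    (fun x hx => soStep_of_not_adj fun h => hx ((SimpleGraph.mem_neighborFinset _ _ _).2 h))]
  rfl

/-- `symbD δ₀ l m ≡ 1` for `m = 0` and `≡ 0` for `m ≥ 1` (only the `x = 0` term survives).
[folklore] -/
theorem symbD_delta0 (l : Fin d) (m : ℕ) (k : Fin d → ℝ) :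
    symbD (delta0 : Site d → ℝ) l m k = if m = 0 then 1 else 0 := by
  rw [symbD_eq_sum (S := {0}) (fun x hx => delta0_of_ne_zero (by simpa using hx)), Finset.sum_singleton]
  simp only [delta0_zero, one_mul, Pi.zero_apply, Int.cast_zero]
  split_ifs with hm
  · subst hm; simp [kdot]
  · rw [zero_pow hm, zero_mul]

/-- Linearity in `P` for finitely supported functions (common support `S`). [folklore] -/
theorem symbD_add_smul {P Q : Site d → ℝ} {S : Finset (Site d)} (hP : ∀ x ∉ S, P x = 0)
    (hQ : ∀ x ∉ S, Q x = 0) (a b : ℝ) (l : Fin d) (m : ℕ) (k : Fin d → ℝ) :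
    symbD (fun x => a * P x + b * Q x) l m k = a * symbD P l m k + b * symbD Q l m k := by
  rw [symbD_eq_sum (S := S) (fun x hx => by rw [hP x hx, hQ x hx]; ring), symbD_eq_sum hP,
    symbD_eq_sum hQ, Finset.mul_sum, Finset.mul_sum, ← Finset.sum_add_distrib]
  exact Finset.sum_congr rfl fun x _ => by ring

/-- The pointwise bound `|symbD P l m k| ≤ Σ_x |P(x)| |x_l|^m` (finite support). [folklore] -/
theorem abs_symbD_le {P : Site d → ℝ} {S : Finset (Site d)} (hS : ∀ x ∉ S, P x = 0) (l : Fin d) (m : ℕ)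
    (k : Fin d → ℝ) :
    |symbD P l m k| ≤ ∑ x ∈ S, |P x| * |((x l : ℤ) : ℝ)| ^ m := by
  rw [symbD_eq_sum hS]
  refine (Finset.abs_sum_le_sum_abs _ _).trans (Finset.sum_le_sum fun x _ => ?_)
  rw [abs_mul, abs_mul, abs_pow]
  exact mul_le_mul_of_nonneg_left (mul_le_of_le_one_right (pow_nonneg (abs_nonneg _) _)
    (Real.abs_cos_le_one _)) (abs_nonneg _)

/-- **The transform of an even, absolutely summable `P` is real and equals `symbD P l 0`**:
`P̂(k) = Σ_x P(x)cos(k·x)` (cube-side `latticeFT`). [folklore] -/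
theorem latticeFT_eq_symbD_zero {P : Site d → ℝ} (hP : Summable fun x => |P x|) (hPe : ∀ x, P (-x) = P x)
    (l : Fin d) (k : Fin d → ℝ) :
    latticeFT P k = ((symbD P l 0 k : ℝ) : ℂ) := by
  rw [latticeFT_eq_re_of_even hP hPe, symbD_zero]

/-! ### Slice calculus for finitely supported `P` -/

section Slice

variable {P : Site d → ℝ} {S : Finset (Site d)}

/-- Along the slice `s ↦ k[l↦s]` each term is `c cos(a s + b)`:
`symbD P l m (k[l↦s]) = Σ_x P(x) x_l^m cos(x_l s + (k·x - k_l x_l) + mπ/2)`. [folklore] -/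
theorem symbD_update (hS : ∀ x ∉ S, P x = 0) (l : Fin d) (m : ℕ) (k : Fin d → ℝ) (s : ℝ) :
    symbD P l m (Function.update k l s) = ∑ x ∈ S, P x * (((x l : ℤ) : ℝ) ^ m *
      Real.cos (((x l : ℤ) : ℝ) * s + (kdot k x - k l * ((x l : ℤ) : ℝ) + m * (π / 2)))) := by
  rw [symbD_eq_sum hS]
  exact Finset.sum_congr rfl fun x _ => by rw [kdot_update_eq_affine, add_assoc]

/-- **Slice derivative**: `(d/ds) symbD P l m (k[l↦s]) |_{s = k_l} = symbD P l (m+1) k`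
(finitely supported `P`). [cite: LiuSlade2024, Appendix A, Lemma A.4] -/
theorem hasDerivAt_symbD_slice (hS : ∀ x ∉ S, P x = 0) (l : Fin d) (m : ℕ) (k : Fin d → ℝ) :
    HasDerivAt (fun s => symbD P l m (Function.update k l s)) (symbD P l (m + 1) k) (k l) := by
  have hfun : (fun s => symbD P l m (Function.update k l s)) = fun s => ∑ x ∈ S, P x * (((x l : ℤ) : ℝ) ^ m *
      Real.cos (((x l : ℤ) : ℝ) * s + (kdot k x - k l * ((x l : ℤ) : ℝ) + m * (π / 2)))) :=
    funext fun s => symbD_update hS l m k s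
  rw [hfun, symbD_eq_sum hS]
  refine HasDerivAt.fun_sum fun x _ => ?_
  -- one term: `c cos(a s + b)`, derivative `-c a sin(a s + b) = c a cos(a s + b + π/2)`
  have h1 : HasDerivAt (fun s : ℝ => ((x l : ℤ) : ℝ) * s + (kdot k x - k l * ((x l : ℤ) : ℝ) + m * (π / 2)))
      ((x l : ℤ) : ℝ) (k l) := by
    simpa using ((hasDerivAt_id (k l)).const_mul ((x l : ℤ) : ℝ)).add_const
      (kdot k x - k l * ((x l : ℤ) : ℝ) + m * (π / 2))
  have h2 := ((Real.hasDerivAt_cos _).comp (k l) h1).const_mul (P x * ((x l : ℤ) : ℝ) ^ m)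
  have harg : ((x l : ℤ) : ℝ) * k l + (kdot k x - k l * ((x l : ℤ) : ℝ) + m * (π / 2)) = kdot k x + m * (π / 2) := by
    ring
  rw [harg] at h2
  have hval : P x * ((x l : ℤ) : ℝ) ^ m * (-Real.sin (kdot k x + m * (π / 2)) * ((x l : ℤ) : ℝ)) =
      P x * (((x l : ℤ) : ℝ) ^ (m + 1) * Real.cos (kdot k x + ((m + 1 : ℕ) : ℝ) * (π / 2))) := by
    rw [Nat.cast_succ, add_mul, one_mul, ← add_assoc, Real.cos_add_pi_div_two, pow_succ]
    ring
  rw [hval] at h2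
  refine h2.congr_of_eventuallyEq (Eventually.of_forall fun s => ?_)
  simp only [Function.comp_apply]
  ring

/-- Continuity of `symbD P l m` on `ℝ^d` (finitely supported `P`). [folklore] -/
theorem continuous_symbD (hS : ∀ x ∉ S, P x = 0) (l : Fin d) (m : ℕ) : Continuous (symbD P l m) := by
  have hfun : symbD P l m = fun k => ∑ x ∈ S, P x * (((x l : ℤ) : ℝ) ^ m * Real.cos (kdot k x + m * (π / 2))) :=
    funext fun k => symbD_eq_sum hS l m k
  rw [hfun]
  refine continuous_finsetSum _ fun x _ => continuous_const.mul (continuous_const.mul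
    (Real.continuous_cos.comp ((continuous_kdot_left x).add continuous_const)))

/-- `2π`-periodicity in `k_l`: `symbD P l m (k[l ↦ s + 2π]) = symbD P l m (k[l ↦ s])` (`x_l ∈ ℤ`).
[folklore] -/
theorem symbD_update_add_two_pi (hS : ∀ x ∉ S, P x = 0) (l : Fin d) (m : ℕ) (k : Fin d → ℝ) (s : ℝ) :
    symbD P l m (Function.update k l (s + 2 * π)) = symbD P l m (Function.update k l s) := by
  rw [symbD_update hS, symbD_update hS]
  refine Finset.sum_congr rfl fun x _ => ?_
  congr 2
  rw [show ((x l : ℤ) : ℝ) * (s + 2 * π) + (kdot k x - k l * ((x l : ℤ) : ℝ) + m * (π / 2)) =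
      ((x l : ℤ) : ℝ) * s + (kdot k x - k l * ((x l : ℤ) : ℝ) + m * (π / 2)) + (x l : ℤ) * (2 * π) by ring,
    Real.cos_add_int_mul_two_pi]

/-- The periodicity across the faces `k_l = ∓π` of the cube. [folklore] -/
theorem symbD_update_neg_pi (hS : ∀ x ∉ S, P x = 0) (l : Fin d) (m : ℕ) (k : Fin d → ℝ) :
    symbD P l m (Function.update k l (-π)) = symbD P l m (Function.update k l π) := by
  rw [← symbD_update_add_two_pi hS l m k (-π)]
  congr 2
  ring

end Slice

/-! ## Part 2. The truncation of `Π` -/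

/-- The finite set of lattice points with `|x| ≤ R`. [folklore] -/
theorem finite_euclidNorm_le (d : ℕ) (R : ℝ) : Set.Finite {x : Site d | euclidNorm x ≤ R} := by
  have hsub : {x : Site d | euclidNorm x ≤ R} ⊆ Metric.closedBall (0 : Site d) R := fun x hx => by
    rw [Metric.mem_closedBall, dist_zero_right]
    exact (norm_le_euclidNorm x).trans hx
  exact ((isCompact_closedBall (0 : Site d) R).finite_of_discrete).subset hsub

/-- **The truncation of `Π` to `|x| ≤ R`, with the tail mass put back at the origin**:
`piTrunc P R x = P(x)1{|x| ≤ R} + (Σ_{|y| > R} P(y)) δ_{0,x}`. It is finitely supported,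
`ℤ^d`-symmetric with `P`, and has the same total sum as `P` (so that Assumption 2.1's
`F̂_z(0) ≥ 0` is preserved). [cite: LiuSlade2026, Assumption 2.1 (the class of Π_z to which the truncation must belong)] -/
def piTrunc (P : Site d → ℝ) (R : ℝ) (x : Site d) : ℝ :=
  (if euclidNorm x ≤ R then P x else 0) + (∑' y, if euclidNorm y ≤ R then (0 : ℝ) else P y) * delta0 x

/-- The tail `Σ_{|y| > R} P(y)`. [folklore] -/
def piTail (P : Site d → ℝ) (R : ℝ) : ℝ := ∑' y, if euclidNorm y ≤ R then (0 : ℝ) else P y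

/-- `piTrunc` unfolded through `piTail`. [folklore] -/
theorem piTrunc_apply (P : Site d → ℝ) (R : ℝ) (x : Site d) :
    piTrunc P R x = (if euclidNorm x ≤ R then P x else 0) + piTail P R * delta0 x := rfl

/-- The support of `piTrunc P R` lies in `{|x| ≤ R} ∪ {0}`, a finite set; here as a `Finset`
statement for `R ≥ 0`. [folklore] -/
theorem piTrunc_eq_zero_of_lt {P : Site d → ℝ} {R : ℝ} (hR : 0 ≤ R) {x : Site d}
    (hx : x ∉ (finite_euclidNorm_le d R).toFinset) : piTrunc P R x = 0 := by
  rw [Set.Finite.mem_toFinset, Set.mem_setOf_eq, not_le] at hx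
  have hx0 : x ≠ 0 := fun h => by
    subst h
    simp [euclidNorm] at hx
    linarith
  rw [piTrunc_apply, if_neg (not_le.2 hx), delta0_of_ne_zero hx0, mul_zero, add_zero]

/-- The tail is absolutely convergent and small: `|piTail P R| ≤ Σ_{|y| > R} |P(y)|`, and it tends
to `0` as `R → ∞` for absolutely summable `P`. [folklore] -/
theorem abs_piTail_le {P : Site d → ℝ} (hP : Summable fun x => |P x|) (R : ℝ) :
    |piTail P R| ≤ ∑' y, if euclidNorm y ≤ R then (0 : ℝ) else |P y| := by
  unfold piTail
  have hs : Summable fun y => if euclidNorm y ≤ R then (0 : ℝ) else |P y| :=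
    Summable.of_nonneg_of_le (fun y => by split_ifs <;> simp [abs_nonneg])
      (fun y => by split_ifs <;> simp [abs_nonneg]) hP
  have := norm_tsum_le_tsum_norm (f := fun y => if euclidNorm y ≤ R then (0 : ℝ) else P y)
    (by refine hs.congr fun y => ?_; split_ifs <;> simp)
  rw [Real.norm_eq_abs] at this
  refine this.trans (le_of_eq (tsum_congr fun y => ?_))
  split_ifs <;> simp

/-- `piTail P R → 0` as `R → ∞` (absolutely summable `P`). [folklore] -/
theorem tendsto_piTail_atTop {P : Site d → ℝ} (hP : Summable fun x => |P x|) :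
    Tendsto (piTail P) atTop (𝓝 0) := by
  -- dominated convergence for series: the terms vanish eventually pointwise, dominated by `|P|`
  have h : Tendsto (fun R : ℝ => ∑' y : Site d, (if euclidNorm y ≤ R then (0 : ℝ) else P y)) atTop
      (𝓝 (∑' _y : Site d, (0 : ℝ))) := by
    refine tendsto_tsum_of_dominated_convergence (bound := fun y => |P y|) hP (fun y => ?_) ?_
    · -- pointwise: for `R ≥ |y|` the term is `0`
      refine tendsto_const_nhds.congr' ?_
      filter_upwards [eventually_ge_atTop (euclidNorm y)] with R hR
      rw [if_pos hR]
    · exact Eventually.of_forall fun R => fun y => by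
        split_ifs <;> simp [abs_nonneg]
  rw [tsum_zero] at h
  exact h

/-- **Total sum is preserved**: `Σ_x piTrunc P R x = Σ_x P(x)` (summable `P`). [folklore] -/
theorem tsum_piTrunc {P : Site d → ℝ} (hP : Summable fun x => |P x|) (R : ℝ) :
    ∑' x, piTrunc P R x = ∑' x, P x := by
  have h1 : Summable fun x : Site d => if euclidNorm x ≤ R then P x else 0 :=
    Summable.of_norm_bounded hP fun x => by split_ifs <;> simp
  have h2 : Summable fun x : Site d => if euclidNorm x ≤ R then (0 : ℝ) else P x :=
    Summable.of_norm_bounded hP fun x => by split_ifs <;> simp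
  have h3 : Summable fun x : Site d => piTail P R * delta0 x := (hasSum_delta0.mul_left _).summable
  simp_rw [piTrunc_apply]
  rw [Summable.tsum_add h1 h3, tsum_mul_left, hasSum_delta0.tsum_eq, mul_one, piTail,
    ← Summable.tsum_add h1 h2]
  exact tsum_congr fun x => by split_ifs <;> simp

/-- **`ℤ^d`-symmetry is preserved** (`|σx| = |x|`, `σ0 = 0`). [folklore] -/
theorem isZdSymmetric_piTrunc {P : Site d → ℝ} (hP : IsZdSymmetric P) (R : ℝ) :
    IsZdSymmetric (piTrunc P R) := by
  intro σ ε x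
  simp only [piTrunc_apply, euclidNorm_signedPerm, hP σ ε x]
  congr 1
  unfold delta0
  simp only [signedPerm_eq_zero_iff]

/-- **The decay bound is preserved up to the tail at the origin**: if
`|P(x)| ≤ β₀δ_{0,x} + β₁/⟦x⟧^s` then `|piTrunc P R x| ≤ (β₀ + |piTail P R|)δ_{0,x} + β₁/⟦x⟧^s`
(`β₁ ≥ 0`). [cite: LiuSlade2026, Assumption 2.1 with (2.2)] -/
theorem abs_piTrunc_le {P : Site d → ℝ} {β₀ β₁ s : ℝ} (hβ₁ : 0 ≤ β₁)
    (hbd : ∀ x, |P x| ≤ β₀ * delta0 x + β₁ / jnorm x ^ s) (R : ℝ) (x : Site d) :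
    |piTrunc P R x| ≤ (β₀ + |piTail P R|) * delta0 x + β₁ / jnorm x ^ s := by
  rw [piTrunc_apply]
  have hj : 0 ≤ β₁ / jnorm x ^ s := div_nonneg hβ₁ (Real.rpow_nonneg (jnorm_pos x).le s)
  by_cases hx : x = 0
  · subst hx
    simp only [delta0_zero, mul_one]
    have h0 := hbd 0
    rw [delta0_zero, mul_one] at h0
    calc |(if euclidNorm (0 : Site d) ≤ R then P 0 else 0) + piTail P R|
        ≤ |(if euclidNorm (0 : Site d) ≤ R then P 0 else 0)| + |piTail P R| := abs_add_le _ _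
      _ ≤ (β₀ + β₁ / jnorm (0 : Site d) ^ s) + |piTail P R| := by
          gcongr
          split_ifs
          · exact h0
          · rw [abs_zero]; linarith [abs_nonneg (P 0)]
      _ = β₀ + |piTail P R| + β₁ / jnorm (0 : Site d) ^ s := by ring
  · rw [delta0_of_ne_zero hx, mul_zero, mul_zero, add_zero, zero_add]
    have h := hbd x
    rw [delta0_of_ne_zero hx, mul_zero, zero_add] at h
    split_ifs
    · exact h
    · rw [abs_zero]; exact hj

/-- `piTrunc P R x → P x` for every `x` as `R → ∞` (eventually equal for `x ≠ 0`; at `x = 0` by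
`piTail → 0`). [folklore] -/
theorem tendsto_piTrunc_atTop {P : Site d → ℝ} (hP : Summable fun x => |P x|) (x : Site d) :
    Tendsto (fun R => piTrunc P R x) atTop (𝓝 (P x)) := by
  have h1 : Tendsto (fun R : ℝ => if euclidNorm x ≤ R then P x else 0) atTop (𝓝 (P x)) := by
    refine tendsto_const_nhds.congr' ?_
    filter_upwards [eventually_ge_atTop (euclidNorm x)] with R hR
    rw [if_pos hR]
  have h2 : Tendsto (fun R : ℝ => piTail P R * delta0 x) atTop (𝓝 (0 * delta0 x)) :=
    (tendsto_piTail_atTop hP).mul_const _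
  rw [zero_mul] at h2
  have hf : (fun R => piTrunc P R x) = fun R => (if euclidNorm x ≤ R then P x else 0) + piTail P R * delta0 x := rfl
  rw [hf]
  simpa using h1.add h2

end Literature.Barriers.CriticalPhenomena.SpreadOutIsing

end
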